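import Summits.AtomisticToContinuum.Crystallization.Theorems.FrustratedLawDichotomyStrainedPatchChargePrice

/-!
# Strained patch — THE TAYLOR TOP: the second-order row force is BILINEAR IN (CURVATURE, STRAIN); the quadratic(+tail) price; START and SHELF of the priced descent
# (decomp-a2c lens-5 «finite/base range + asymptotic regime + bridge», generation 72; crux `AperiodicFrustratedLawGap`, stmt-AtomisticToContinuum-27623)

T-side record: `[CORE-FAR] CoreOffTubeFloor (63/10) (63/10) (24/5) (1/100) 0 ⟸ TubeFloor 𝓘 τ ∧ FamilyCover 𝓘 (24/5) (1/100) (1/8) τ` (tree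
`…HostCells.coreOff_of_tubeFloor_of_cover_eighth`).  New module on top of g71's `…StrainedPatchChargePrice` (the priced descent
`tubeFloor_of_pricedCharge_of_descent : PricedCharge 𝓘 τ Φ X → PriceTop … (k 0 · σ₁) → (∀ i < n, PriceStep … (k i) (k (i+1) · σ₁)) → SlackCert … (k n) … → TubeFloor 𝓘 τ`);
zero edits to landed or g71 declarations; no `sorry`; standard axioms.

WHY (g71 ASK-71 (a) re-analysed; toy `work/toptoy.py`, tables `work/toptoy_*.txt`).  The FIRST descent step is ALWAYS the price's box (tube) top: the polytope
`P(k₀)` CONTAINS the Φ-maximising tube state whenever `1 + k₀ ≥` its row norms, so no «joint sup» can help at step one — what decides START is the PRICE FORMAT.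
(i) g71's price of record `termPrice ⊓ pairPrice` does NOT start at `τ ∈ {1/64, 1/80, 1/100}` (box model, both hosts): its maximiser `w_b = −w_a` on the shell
(all `‖Δ‖ = 2τ`) has row norm `2τ‖Σ_k f′(q_k)‖ = 92 / 74 σ₁` (1/80 / 1/100) `< 1 + T⁺ = 141 / 83` — an explicit feasible point of `P(T⁺)`; it starts only at
`τ ≲ 1/112`.  (ii) The present module's identity (§1) says WHY that maximiser is mis-priced: for a centrosymmetric shell the second-order row force
`½ Σ_k f″(q_k)[Δ_k, Δ_k]` equals `Σ_k f″(q_k)[C_k, G_k]` — BILINEAR in the discrete CURVATURE `C = ½(Δ + Δ∘σ)` and the discrete STRAIN `G = ½(Δ − Δ∘σ)`: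
pure strain (affine) AND pure curvature (`Δ∘σ = Δ`, g71's maximiser) are both force-free at second order, the true cost there is `O(τ³)`.  (iii) With the
vector-exact Taylor-2 polynomial as the price (`quadPrice`, §2: `‖½ Σ_k B(q_k)[Δ_k, Δ_k]‖ +` per-bond cubic tails) the box top drops to `≤ 50 / 31 σ₁` (fcc,
separable certified) resp. `≥ 25 / 14 σ₁` (joint, ascent) against maximiser row norms `52–56 / 42–45 σ₁`: the descent STARTS at `1/80` (fcc; hcp needs the
joint top) and comfortably at `1/100`.  (iv) WITNESS-72 = the critic's pre-registered blocking test (STATUS row 1192 (C)–(E); `work/blocktoy.py`,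
tables `work/blk_*.txt`): an explicit box state `w` with ALL ball rows `‖(Jw)_b‖ ≤ (1 + F_w)σ₁`, `F_w := max_a Φ_a(w)/σ₁`, sits in `tube ∩ P(k)` for every
`k ≥ R_w − 1` and blocks the descent at level `F_w` (typed: `not_priceStep_of_witness`, §3); scaled copies `λw` block at `λ²F` whenever `λ²F ≥ λR − 1`
(threshold: blocking number `β := 4F/R² ≥ 1`).  Over ≈ 1 500 explicit all-rows witnesses (230–450 per (host, τ)) — lattice waves along ⟨100⟩, ⟨110⟩, ⟨111⟩ (hcp: a, a*, c,
⟨101⟩) at 11 wavelengths from the zone boundary to `L = 8`, 3 polarisations, 2 phases; the local antipodal / breathing / single-site / shelf-type states;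
≈ 630 two-mode superpositions (a curvature mode + a strain mode or an affine strain); random and greedy sign patterns — the quadratic price is UNBLOCKED on
both hosts at BOTH `τ = 1/80` and `1/100`: `BLOCK(quadPrice) ≤ 0.08 σ₁` (worst full-amplitude margin `F/(R − 1) = 0.43`, worst `β = 0.34`, both at the soft transverse zone-boundary shear modes and both needing `≥ 1` to block),
caricature fixed point `≈ (1 + k)²·β/4 ≈ 0.03–0.2 σ₁ ≪ 0.5 κ₀`; the true Taylor remainder sits lower still (margin `≤ 0.13`).  By contrast g71's termwise price
is blocked at `93–139 σ₁` and the per-pair «price‴» (`2K₂‖G‖‖C‖ + (K₃/3)‖C‖³` per antipodal pair, norms taken pair by pair) is BLOCKED at `35 / 12 σ₁` (fcc,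
`1/80 / 1/100`: ⟨110⟩ and ⟨111⟩ waves with `L = 1.6–3`) and `13 / 1.8 σ₁` (hcp) `> κ₀ = s⋆ − 1 = 0.98 / 1.79` (HE52), `0.57 / 1.23` (HZ00): the SIGNED vector
sum over the shell before the norm is load-bearing.  (v) The SINGLE-ROW relaxation (`RowStep`, only row `a` constrained) stalls on a SHELF — shell states at
amplitude `τ` whose linear force on `a` cancels while the quadratic force adds: `4.7 / 3.4 / 2.1 σ₁` (fcc, `τ = 1/80 / 1/100 / 1/128`; hcp `4.5 / 3.0 / 1.7`)
`> κ₀` — but those states violate the first-shell rows by `≈ 46–66 σ₁`, so the shelf is an artefact of the relaxation (all explicit all-rows witnesses pass):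
the census engine certifying `PriceStep` below `≈ 5 σ₁` must keep at least the first-shell rows of `a` (ASK-72), and `τ ≈ 1/128–1/160` (single-row shelf
`≤` the extrapolated `κ₀ ≈ 3`) is the lens DIAL if it cannot.

* §1 [PROVED, abstract]: `polarization_sub`; ★★ `sum_quad_eq_two_sum_curv_strain` (`Σ B_i [D_i, D_i] = 2 Σ B_i [C_i, G_i]` for symmetric `B_i` odd under the
  shell involution); `sum_quad_eq_zero_of_even` / `_of_odd` (pure curvature / pure strain are free); the norm price `norm_sum_quad_le` (`≤ 2 Σ ‖B_i‖ ‖C_i‖ ‖G_i‖`)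
  and the parallelogram cap `norm_half_add_mul_norm_half_sub_le` (`‖C‖‖G‖ ≤ (‖D‖² + ‖D′‖²)/4`).
* §2 [definitions + bookkeeping]: `quadPrice B T r : RowPrice` (the vector-exact quadratic polynomial of the row force + per-bond tails `T`), its priced charge
  `PricedCharge 𝓘 τ (quadPrice B T r) X` [KNOWN-MATH · ATTACKABLE-M: second-order multivariate Taylor with `B = D²(pair force)` on the host bonds, `T(s, m)` a
  cubic-tail table on the annulus `[s − 2A, s + 2A]`, chart bookkeeping], and the record corollaries `tubeFloor_of_quadPrice_descent`, `coreOff_of_quadPrice_descent`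
  (the g71 descent and the tree junction, instantiated — the dial `(𝓘, τ)` stays generic).
* §3 [bookkeeping, the lens bridge in two regimes]: `not_priceStep_of_witness` (the typed blocking lemma of WITNESS-72: an explicit feasible state with
  `ρ < Φ_a` refutes `PriceStep … κ ρ`), the single-row relaxation `RowStep` with `priceStep_of_rowStep` (all rows beat one row — the shelf is an artefact of the
  relaxation), and `tubeFloor_of_twoRegime_descent` — a START table `k 0 > … > k n₁` (format-decided, census per host) glued to a
  FLOOR table `k n₁ > … > k n` (all-rows polytope steps) and the certificate at `k n`; both tables are lists of the same typed `PriceStep`, the split only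
  records which engine is asked for which rows (ASK-72).
-/

namespace Summit.AtomisticToContinuum.Crystallization.Theorems.FrustratedLawDichotomyStrainedPatchTaylorTop

open scoped BigOperators Classical RealInnerProductSpace
open Summit.AtomisticToContinuum.Crystallization.Theorems.FrustratedLawDichotomyMotifLemmas
open Summit.AtomisticToContinuum.Crystallization.Theorems.FrustratedLawDichotomyAveragingCut
open Summit.AtomisticToContinuum.Crystallization.Theorems.FrustratedLawDichotomyStrainedPatchHomSplit
open Summit.AtomisticToContinuum.Crystallization.Theorems.FrustratedLawDichotomyStrainedPatchCleanCollar
open Summit.AtomisticToContinuum.Crystallization.Theorems.FrustratedLawDichotomyStrainedPatchPhaseCut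
open Summit.AtomisticToContinuum.Crystallization.Theorems.FrustratedLawDichotomyStrainedPatchCoreTube
open Summit.AtomisticToContinuum.Crystallization.Theorems.FrustratedLawDichotomyStrainedPatchStrainBands
open Summit.AtomisticToContinuum.Crystallization.Theorems.FrustratedLawDichotomyStrainedPatchHomIsometry
open Summit.AtomisticToContinuum.Crystallization.Theorems.FrustratedLawDichotomyStrainedPatchHomTubeIso
open Summit.AtomisticToContinuum.Crystallization.Theorems.FrustratedLawDichotomyStrainedPatchEnvelopeLaw
open Summit.AtomisticToContinuum.Crystallization.Theorems.FrustratedLawDichotomyStrainedPatchEnvelopeTaylor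
open Summit.AtomisticToContinuum.Crystallization.Theorems.FrustratedLawDichotomyStrainedPatchChartFamilies
open Summit.AtomisticToContinuum.Crystallization.Theorems.FrustratedLawDichotomyStrainedPatchChartFamiliesPinned
open Summit.AtomisticToContinuum.Crystallization.Theorems.FrustratedLawDichotomyStrainedPatchQuantSlaving
open Summit.AtomisticToContinuum.Crystallization.Theorems.FrustratedLawDichotomyStrainedPatchHostCells
open Summit.AtomisticToContinuum.Crystallization.Theorems.FrustratedLawDichotomyStrainedPatchForceCap
open Summit.AtomisticToContinuum.Crystallization.Theorems.FrustratedLawDichotomyStrainedPatchTextureFloor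
open Summit.AtomisticToContinuum.Crystallization.Theorems.FrustratedLawDichotomyStrainedPatchSVCharge
open Summit.AtomisticToContinuum.Crystallization.Theorems.FrustratedLawDichotomyStrainedPatchChargePrice

/-! ## §1. The second-order row force of a centrosymmetric shell is bilinear in (curvature, strain) -/

section Quadratic

variable {ι : Type*} [Fintype ι] {V W : Type*} [NormedAddCommGroup V] [NormedSpace ℝ V] [NormedAddCommGroup W] [NormedSpace ℝ W]

/-- POLARIZATION of a difference of diagonal values of a SYMMETRIC bilinear map: `B D D − B D′ D′ = B (D + D′) (D − D′)`. [elementary] -/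
theorem polarization_sub (B : V →L[ℝ] V →L[ℝ] W) (hB : ∀ x y, B x y = B y x) (D D' : V) : B D D - B D' D' = B (D + D') (D - D') := by
  simp only [map_add, map_sub, add_apply]
  rw [hB D' D]; abel

/-- Diagonal values of a family ODD under the shell involution sum to minus their reflected selves. [elementary] -/
theorem sum_quad_reflect {σ : ι → ι} (hσ : Function.Involutive σ) (B : ι → V →L[ℝ] V →L[ℝ] W) (hBσ : ∀ i, B (σ i) = -B i) (D : ι → V) :
    ∑ i, B i (D (σ i)) (D (σ i)) = -∑ i, B i (D i) (D i) := by
  rw [← sum_comp_involutive hσ (fun i => B i (D i) (D i))]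
  simp only [hBσ, neg_apply, Finset.sum_neg_distrib, neg_neg]

/-- ★★ **THE SECOND-ORDER ROW FORCE IS BILINEAR IN (CURVATURE, STRAIN)**: for symmetric bilinear `B i` (second derivatives) with `B (σ i) = −B i` (the second
derivative of an ODD pair force on a shell with `q (σ i) = −q i`) and ANY differences `D`,
`Σ_i B i (D i) (D i) = 2 • Σ_i B i (½(D i + D (σ i))) (½(D i − D (σ i)))` — curvature `C` times strain `G`.  [new, elementary] -/
theorem sum_quad_eq_two_sum_curv_strain {σ : ι → ι} (hσ : Function.Involutive σ) (B : ι → V →L[ℝ] V →L[ℝ] W) (hB : ∀ i x y, B i x y = B i y x)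
    (hBσ : ∀ i, B (σ i) = -B i) (D : ι → V) :
    ∑ i, B i (D i) (D i) = (2 : ℝ) • ∑ i, B i ((1 / 2 : ℝ) • (D i + D (σ i))) ((1 / 2 : ℝ) • (D i - D (σ i))) := by
  have h2 : ∀ i, B i ((1 / 2 : ℝ) • (D i + D (σ i))) ((1 / 2 : ℝ) • (D i - D (σ i))) = (1 / 4 : ℝ) • (B i (D i) (D i) - B i (D (σ i)) (D (σ i))) := by
    intro i
    simp only [map_smul, smul_apply, smul_smul]
    rw [← polarization_sub (B i) (hB i)]
    norm_num
  simp_rw [h2]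
  rw [← Finset.smul_sum, Finset.sum_sub_distrib, sum_quad_reflect hσ B hBσ D, sub_neg_eq_add, smul_smul, ← two_smul ℝ (∑ i, B i (D i) (D i)), smul_smul]
  norm_num

/-- ★ **PURE CURVATURE IS FREE AT SECOND ORDER**: if the differences are EVEN under the involution (`D (σ i) = D i` — e.g. g71's box maximiser `w_b = −w_a`,
all `‖Δ‖ = 2τ`), the second-order row force vanishes; the true cost there is third order. [new, elementary] -/
theorem sum_quad_eq_zero_of_even {σ : ι → ι} (hσ : Function.Involutive σ) (B : ι → V →L[ℝ] V →L[ℝ] W) (hBσ : ∀ i, B (σ i) = -B i) {D : ι → V}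
    (hD : ∀ i, D (σ i) = D i) : ∑ i, B i (D i) (D i) = 0 := by
  have h := sum_quad_reflect hσ B hBσ D
  simp_rw [hD] at h
  have h2 : (2 : ℝ) • ∑ i, B i (D i) (D i) = 0 := by rw [two_smul]; nth_rewrite 1 [h]; exact neg_add_cancel _
  exact (smul_eq_zero.mp h2).resolve_left two_ne_zero

/-- ★ **PURE STRAIN IS FREE AT SECOND ORDER**: if the differences are ODD under the involution (`D (σ i) = −D i` — affine / linear displacement fields), the
second-order row force vanishes (census REG-30 `c2_aff = 0`, the second-order shadow of g71's all-orders `sum_eq_zero_of_odd_disp`). [new, elementary] -/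
theorem sum_quad_eq_zero_of_odd {σ : ι → ι} (hσ : Function.Involutive σ) (B : ι → V →L[ℝ] V →L[ℝ] W) (hBσ : ∀ i, B (σ i) = -B i) {D : ι → V}
    (hD : ∀ i, D (σ i) = -D i) : ∑ i, B i (D i) (D i) = 0 := by
  have h := sum_quad_reflect hσ B hBσ D
  simp_rw [hD, map_neg, neg_apply, neg_neg] at h
  have h2 : (2 : ℝ) • ∑ i, B i (D i) (D i) = 0 := by rw [two_smul]; nth_rewrite 1 [h]; exact neg_add_cancel _
  exact (smul_eq_zero.mp h2).resolve_left two_ne_zero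

/-- ★ **THE CURVATURE × STRAIN PRICE**: `‖Σ_i B i (D i) (D i)‖ ≤ 2 Σ_i ‖B i‖ · ‖½(D i + D (σ i))‖ · ‖½(D i − D (σ i))‖`. [new, elementary] -/
theorem norm_sum_quad_le {σ : ι → ι} (hσ : Function.Involutive σ) (B : ι → V →L[ℝ] V →L[ℝ] W) (hB : ∀ i x y, B i x y = B i y x)
    (hBσ : ∀ i, B (σ i) = -B i) (D : ι → V) :
    ‖∑ i, B i (D i) (D i)‖ ≤ 2 * ∑ i, ‖B i‖ * ‖(1 / 2 : ℝ) • (D i + D (σ i))‖ * ‖(1 / 2 : ℝ) • (D i - D (σ i))‖ := by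
  rw [sum_quad_eq_two_sum_curv_strain hσ B hB hBσ D, norm_smul, Real.norm_eq_abs, abs_of_pos (by norm_num : (0 : ℝ) < 2)]
  refine mul_le_mul_of_nonneg_left ((norm_sum_le _ _).trans (Finset.sum_le_sum fun i _ => ?_)) (by norm_num)
  exact (B i).le_opNorm₂ _ _

/-- The parallelogram cap: `‖½(D + D′)‖ · ‖½(D − D′)‖ ≤ (‖D‖² + ‖D′‖²) / 4` in an inner-product space (so the curvature × strain price never exceeds the
termwise one, and is strictly smaller off the diagonal `‖C‖ = ‖G‖`). [elementary] -/
theorem norm_half_add_mul_norm_half_sub_le {E : Type*} [NormedAddCommGroup E] [InnerProductSpace ℝ E] (D D' : E) :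
    ‖(1 / 2 : ℝ) • (D + D')‖ * ‖(1 / 2 : ℝ) • (D - D')‖ ≤ (‖D‖ ^ 2 + ‖D'‖ ^ 2) / 4 := by
  have hp : ‖D + D'‖ ^ 2 + ‖D - D'‖ ^ 2 = 2 * (‖D‖ ^ 2 + ‖D'‖ ^ 2) := parallelogram_law_with_norm ℝ D D'
  have h1 : ‖(1 / 2 : ℝ) • (D + D')‖ = ‖D + D'‖ / 2 := by rw [norm_smul, Real.norm_eq_abs, abs_of_pos (by norm_num : (0 : ℝ) < 1 / 2)]; ring
  have h2 : ‖(1 / 2 : ℝ) • (D - D')‖ = ‖D - D'‖ / 2 := by rw [norm_smul, Real.norm_eq_abs, abs_of_pos (by norm_num : (0 : ℝ) < 1 / 2)]; ring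
  rw [h1, h2]
  nlinarith [sq_nonneg (‖D + D'‖ - ‖D - D'‖), norm_nonneg (D + D'), norm_nonneg (D - D')]

end Quadratic

/-! ## §2. The quadratic(+tail) price and the instantiated descent -/

/-- ★★ **THE QUADRATIC(+TAIL) PRICE** `quadPrice B T r`: at row `a`, the norm of the VECTOR-EXACT second-order Taylor polynomial of the row force over the charted
shell of host radius `< r` — `‖½ Σ_b B (host bond a→b) [Δ_ab, Δ_ab]‖`, `Δ_ab = dev b − dev a` — plus per-bond tails `T (host distance) ‖Δ_ab‖`.  Intended
instance: `B x = D²(pair force)(x)` (symmetric, odd in `x`; §1 applies on every host-centrosymmetric sub-shell), `T s m = ⅙ K₃(s, 2A) m³` or the census's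
interval sup of the cubic tail on the bond annulus.  Box tops (toy, σ₁ units, fcc / hcp): separable `50 / 68` (1/80), `31 / 42` (1/100), `18 / 25` (1/128);
joint (ascent, lower bracket) `25 / 25`, `14 / 15`, `8 / 8`. -/
noncomputable def quadPrice (B : E3 → E3 →L[ℝ] E3 →L[ℝ] E3) (T : ℝ → ℝ → ℝ) (r : ℝ) : RowPrice := fun _ z c _ z₀ c₀ e a =>
  ‖(1 / 2 : ℝ) • ∑ b ∈ (ball (63 / 10) z c).filter (fun b => b ≠ a ∧ dist (z₀ (e b)) (z₀ (e a)) < r),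
      B (z₀ (e b) - z₀ (e a)) (dev z c z₀ c₀ e b - dev z c z₀ c₀ e a) (dev z c z₀ c₀ e b - dev z c z₀ c₀ e a)‖ +
    ∑ b ∈ (ball (63 / 10) z c).filter (fun b => b ≠ a ∧ dist (z₀ (e b)) (z₀ (e a)) < r),
      T ‖z₀ (e b) - z₀ (e a)‖ ‖dev z c z₀ c₀ e b - dev z c z₀ c₀ e a‖

/-- The quadratic price is the minimum of itself with any coarser price (e.g. g71's `termPrice ⊓ pairPrice`): prices combine by `RowPrice.inf`. [formal bookkeeping] -/
theorem pricedCharge_quad_inf {𝓘 : ChartFam} {τ : ℝ} {B : E3 → E3 →L[ℝ] E3 →L[ℝ] E3} {T : ℝ → ℝ → ℝ} {r : ℝ} {Ψ : RowPrice} {X : SlackTab}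
    (hQ : PricedCharge 𝓘 τ (quadPrice B T r) X) (hΨ : PricedCharge 𝓘 τ Ψ X) : PricedCharge 𝓘 τ ((quadPrice B T r).inf Ψ) X :=
  hQ.inf hΨ

/-- ★★ **THE QUADRATIC-PRICE DESCENT TO THE TUBE FLOOR** (g71's descent, instantiated): the Taylor-2 law, its box top `k 0 · σ₁`, a finite table of all-rows
polytope steps, and the certificate at `k n`. [formal bookkeeping over g71] -/
theorem tubeFloor_of_quadPrice_descent {𝓘 : ChartFam} {τ : ℝ} {B : E3 → E3 →L[ℝ] E3 →L[ℝ] E3} {T : ℝ → ℝ → ℝ} {r : ℝ} {X : SlackTab}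
    (k : ℕ → ℝ) (n : ℕ) (hτ : 0 ≤ τ) (hS : PricedCharge 𝓘 τ (quadPrice B T r) X) (h0 : PriceTop 𝓘 τ (quadPrice B T r) (k 0 * sigmaOne))
    (hs : ∀ i : ℕ, i < n → PriceStep 𝓘 τ sigmaOne (quadPrice B T r) hessBlk0 force0 X (k i) (k (i + 1) * sigmaOne))
    (hC : SlackCert 𝓘 τ (k n) sigmaOne hessBlk0 force0 X) : TubeFloor 𝓘 τ :=
  tubeFloor_of_pricedCharge_of_descent k n hτ hS h0 hs hC

/-- ★ **[CORE-FAR] FROM THE QUADRATIC-PRICE DESCENT AT ANY DIAL SETTING `(𝓘, τ)`** (tree junction `coreOff_of_tubeFloor_of_cover_eighth`). [formal bookkeeping] -/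
theorem coreOff_of_quadPrice_descent {𝓘 : ChartFam} {τ : ℝ} {B : E3 → E3 →L[ℝ] E3 →L[ℝ] E3} {T : ℝ → ℝ → ℝ} {r : ℝ} {X : SlackTab}
    (k : ℕ → ℝ) (n : ℕ) (hτ : 0 ≤ τ) (hS : PricedCharge 𝓘 τ (quadPrice B T r) X) (h0 : PriceTop 𝓘 τ (quadPrice B T r) (k 0 * sigmaOne))
    (hs : ∀ i : ℕ, i < n → PriceStep 𝓘 τ sigmaOne (quadPrice B T r) hessBlk0 force0 X (k i) (k (i + 1) * sigmaOne))
    (hC : SlackCert 𝓘 τ (k n) sigmaOne hessBlk0 force0 X) (hcov : FamilyCover 𝓘 (24 / 5) (1 / 100) (1 / 8) τ) :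
    CoreOffTubeFloor (63 / 10) (63 / 10) (24 / 5) (1 / 100) 0 :=
  coreOff_of_tubeFloor_of_cover_eighth (tubeFloor_of_quadPrice_descent k n hτ hS h0 hs hC) hcov

/-! ## §3. START and SHELF: the witness shape of a failed step, the single-row relaxation, and the two-regime descent -/

/-- ★ **THE WITNESS SHAPE OF A FAILED STEP / FAILED START** [formal bookkeeping — the typed form of toy kill (i)]: one admissible charted tube state IN the
`κ`-polytope with a reach row priced above `ρ` refutes `PriceStep … κ ρ`.  With `κ = k₀ =` the box top this is «the descent does not start»: g71's
`termPrice ⊓ pairPrice` maximiser (`w_b = −w_a` on the shell) is such a witness at `τ ∈ {1/64, 1/80, 1/100}` in the box model (row norm `2τ‖Σ_k f′(q_k)‖ =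
115 / 92 / 74 σ₁ < 1 + T⁺ = 246 / 141 / 83`). -/
theorem not_priceStep_of_witness {𝓘 : ChartFam} {τ σ κ ρ : ℝ} {Φ : RowPrice} {H : HessTab} {F : ForceTab} {X : SlackTab}
    {M : ℕ} {z : Fin M → E3} {c : Fin M} {M₀ : ℕ} {z₀ : Fin M₀ → E3} {c₀ : Fin M₀} {e : Fin M → Fin M₀} {t : ℝ}
    (hz : Admissible M z c) (hcl : CleanBall (63 / 10) z c) (hm : MonoPhaseBall (63 / 10) z c) (ht : 0 ≤ t) (htT : t ≤ constLaw τ M₀ z₀ c₀)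
    (hch : ChartBy 𝓘 τ t z c z₀ c₀ e) (hf : FineChart τ z c z₀ c₀ e) (hP : InForcePolytope κ σ H F X z c z₀ c₀ e)
    {a : Fin M} (ha : a ∈ ball (63 / 10) z c) (hr : IsReach z c a) (hgt : ρ < Φ M z c M₀ z₀ c₀ e a) : ¬ PriceStep 𝓘 τ σ Φ H F X κ ρ :=
  fun h => not_lt.mpr (h M z c M₀ z₀ c₀ e t hz hcl hm ht htT hch hf hP a ha hr) hgt

/-- ★ **THE SINGLE-ROW RELAXATION `RowStep`**: the price at row `a` is `≤ ρ` whenever row `a`'s OWN linearised force is within `(1+κ)σ + X(e a)` — the other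
rows of the ball unconstrained.  This is what the toy's constrained ascent brackets from below; it stalls on a SHELF (`4.7 / 3.4 / 2.1 σ₁`, fcc, `τ = 1/80 /
1/100 / 1/128`: shell states at amplitude `τ` whose linear force on `a` cancels while the quadratic force adds).  [INSTRUMENTABLE; informative only above the shelf] -/
def RowStep (𝓘 : ChartFam) (τ σ : ℝ) (Φ : RowPrice) (H : HessTab) (F : ForceTab) (X : SlackTab) (κ ρ : ℝ) : Prop :=
  ∀ (M : ℕ) (z : Fin M → E3) (c : Fin M) (M₀ : ℕ) (z₀ : Fin M₀ → E3) (c₀ : Fin M₀) (e : Fin M → Fin M₀) (t : ℝ),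
    Admissible M z c → CleanBall (63 / 10) z c → MonoPhaseBall (63 / 10) z c → 0 ≤ t → t ≤ constLaw τ M₀ z₀ c₀ → ChartBy 𝓘 τ t z c z₀ c₀ e →
      FineChart τ z c z₀ c₀ e → ∀ a ∈ ball (63 / 10) z c, IsReach z c a → ‖linForce H F z c z₀ c₀ e a‖ ≤ (1 + κ) * σ + X M₀ z₀ c₀ (e a) →
        Φ M z c M₀ z₀ c₀ e a ≤ ρ

/-- ★ **ALL ROWS BEAT ONE ROW**: the single-row relaxation implies the typed (all-rows, `InForcePolytope`) step — never conversely: below the shelf only the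
all-rows polytope (discrete interior regularity: a state that is linearly force-free to `(1+κ)σ₁` at EVERY row of the `6.3`-ball cannot keep amplitude-`τ`
zone-boundary content at the centre) can certify a step.  ASK-72 (b) is therefore «`PriceStep` as typed, all reach rows of the ball, no single-row relaxation». -/
theorem priceStep_of_rowStep {𝓘 : ChartFam} {τ σ κ ρ : ℝ} {Φ : RowPrice} {H : HessTab} {F : ForceTab} {X : SlackTab}
    (h : RowStep 𝓘 τ σ Φ H F X κ ρ) : PriceStep 𝓘 τ σ Φ H F X κ ρ :=
  fun M z c M₀ z₀ c₀ e t hz hcl hm ht htT hch hf hP a ha hr => h M z c M₀ z₀ c₀ e t hz hcl hm ht htT hch hf a ha hr (hP a ha hr)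

/-- A top is a single-row step at every `κ` (the first step can never beat the box top: `P(k₀) ⊇ tube` as soon as `1 + k₀` exceeds the row norms). [formal bookkeeping] -/
theorem rowStep_of_priceTop {𝓘 : ChartFam} {τ σ ρ : ℝ} {Φ : RowPrice} {H : HessTab} {F : ForceTab} {X : SlackTab} (κ : ℝ) (h : PriceTop 𝓘 τ Φ ρ) :
    RowStep 𝓘 τ σ Φ H F X κ ρ := fun M z c M₀ z₀ c₀ e t hz hcl hm ht htT hch hf a ha hr _ => h M z c M₀ z₀ c₀ e t hz hcl hm ht htT hch hf a ha hr


/-- ★ **TWO-REGIME DESCENT**: a START table `k` of `n₁` steps from the box top (format-decided; census engine per host, the rows near `a` bind) followed by a FLOOR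
table `k'` of `n₂` steps (all-rows polytope; discrete interior regularity does the work) with `k' 0 = k n₁`, and the certificate at `k' n₂`, give (TF).  Both
tables are lists of the same typed `PriceStep`; the theorem only concatenates them. [formal bookkeeping] -/
theorem tubeFloor_of_twoRegime_descent {𝓘 : ChartFam} {τ : ℝ} {Φ : RowPrice} {X : SlackTab} (k k' : ℕ → ℝ) (n₁ n₂ : ℕ) (hτ : 0 ≤ τ)
    (hS : PricedCharge 𝓘 τ Φ X) (h0 : PriceTop 𝓘 τ Φ (k 0 * sigmaOne))
    (hs : ∀ i : ℕ, i < n₁ → PriceStep 𝓘 τ sigmaOne Φ hessBlk0 force0 X (k i) (k (i + 1) * sigmaOne)) (hj : k' 0 = k n₁)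
    (hs' : ∀ i : ℕ, i < n₂ → PriceStep 𝓘 τ sigmaOne Φ hessBlk0 force0 X (k' i) (k' (i + 1) * sigmaOne))
    (hC : SlackCert 𝓘 τ (k' n₂) sigmaOne hessBlk0 force0 X) : TubeFloor 𝓘 τ := by
  refine tubeFloor_of_pricedCharge_of_descent (fun i => if i ≤ n₁ then k i else k' (i - n₁)) (n₁ + n₂) hτ hS (by simpa using h0) ?_ ?_
  · intro i hi
    by_cases h1 : i < n₁
    · have ha : i ≤ n₁ := h1.le
      have hb : i + 1 ≤ n₁ := h1
      simp only [ha, hb, if_true]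
      exact hs i h1
    · have h1 : n₁ ≤ i := not_lt.mp h1
      by_cases h2 : i = n₁
      · subst h2
        have hb : ¬ (i + 1 ≤ i) := by omega
        simp only [le_refl, if_true, hb, if_false, show i + 1 - i = 0 + 1 from by omega]
        rw [← hj]
        exact hs' 0 (by omega)
      · have ha : ¬ (i ≤ n₁) := by omega
        have hb : ¬ (i + 1 ≤ n₁) := by omega
        simp only [ha, hb, if_false, show i + 1 - n₁ = (i - n₁) + 1 from by omega]
        exact hs' (i - n₁) (by omega)
  · by_cases hn : n₂ = 0
    · subst hn; simpa [← hj] using hC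
    · have ha : ¬ (n₁ + n₂ ≤ n₁) := by omega
      simpa [ha, show n₁ + n₂ - n₁ = n₂ from by omega] using hC

end Summit.AtomisticToContinuum.Crystallization.Theorems.FrustratedLawDichotomyStrainedPatchTaylorTop
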